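import Literature.Computability.QuantumComplexity.PhaseQueryOps
import HarnessLib

/-!
# Garbage-free reversible computation of `FP` functions with PLAIN BINARY results

Topic `Literature/Computability/QuantumComplexity`, sequel of `RevUncompute.lean` (Bennett's
compute–copy–uncompute block `RevClean.cleanOps e M n₀ v` of a polynomial-time machine `M`: on the data
`d` it writes the READ-OUT of the output word — the one-hot codes of the cells of the output stack — on
fresh result wires, `RevClean.clEval_cleanOps`). An INTERFERING consumer (a quantum Fourier transform
applied to a computed register, as in the periodisation step `|x⟩|j⟩ ↦ |x + jp⟩` of the QFT over `ℤ_p`,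
`Cryptography/PeriodisedFourierTransform.lean`, inside van Dam–Seroussi's Gauss-sum algorithm) cannot use
the one-hot read-out: the `false`-code and emptiness wires of every cell are garbage correlated with the
value. It needs the output word as PLAIN BITS on designated wires and nothing else. This file provides
that, using the fact that the Bennett block is an involution of ALL assignments
(`RevClean.clEval_cleanOps_cleanOps`, `PhaseQueryOps.lean`; Bennett 1973, §2; Nielsen–Chuang 2010,
§3.2.5 eq. (3.7)):

* `RevClean.bitPairs`, `RevClean.binOps e M n₀ v m z₀ = cleanOps ++ copy ++ cleanOps` — copy the
  `true`-code wire of each of the first `m` output cells (`CWrap.symTrue`, `CWrap.outBit_symTrue_eq`)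
  onto the fresh wires `z₀, …, z₀ + m − 1`, then run the block AGAIN, which erases the read-out;
  **`RevClean.clEval_binOps`** — on the data `d` (machine halting on `d ++ v` with output `l'`,
  `m ≤ |l'|`, `z₀ ≥ width`): data unchanged, wires `z₀ + j` hold the bits `l'[j]`, `j < m`, and EVERY
  other wire is `0` — `|d⟩|0⟩ ↦ |d⟩|0…0⟩|l'[0..m)⟩` with no garbage at all; well-formedness and wire
  bounds (`binOps_wf`, `binOps_lt`) for the compilation to Clifford+`T` (`revCompile`);
  `clEval_binOps_zone` — the same with a pre-filled target zone (the bits are XORed on);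
* `RevClean.eraseOps` — ERASING a field of the data that is a function of the rest: recompute it on
  fresh wires, XOR it onto the field, recompute again; **`RevClean.clEval_eraseOps`**:
  `|d⟩|0⟩ ↦ |zeroField d o m⟩|0⟩` — the in-place half of every reversible register transform
  (`|x⟩|0⟩ ↦ |x⟩|f x⟩ ↦ |0⟩|f x⟩` when `x` is recoverable from `f x`).

Everything here is proved; definitions have bodies; no named fact is introduced.

## References

* C. H. Bennett, *Logical reversibility of computation*, IBM J. Res. Develop. 17 (1973) 525–532, §2
  (through the held restatements below).
* P. W. Shor, SIAM J. Comput. 26 (1997) 1484–1509, §3 p. 8 (compute, copy, undo) [Shor1997].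
* M. A. Nielsen, I. L. Chuang, *Quantum Computation and Quantum Information*, CUP 2010, §3.2.5
  (uncomputation, eq. (3.7)) [NielsenChuang2010].
-/

namespace Literature.Computability.QuantumComplexity

namespace RevClean

open Complexity Complexity.FinTM2Sim Turing Function RevSim CWrap

variable {e : ℕ} {M : TM2ComputableAux Bool Bool}

/-! ### Plain binary results -/

variable (e M)

/-- The copy pairs: the `true`-code result wire of output cell `j` onto the fresh wire `z₀ + j`,
`j < m`. [folklore] -/
noncomputable def bitPairs (n m z₀ : ℕ) : List (ℕ × ℕ) :=
  (List.range m).map fun j => (resW e M n j (symTrue M), z₀ + j)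

/-- **The binary block**: the Bennett block, the copy of the first `m` output bits onto
`z₀ … z₀ + m − 1`, and the Bennett block again (erasing the read-out).
[cite: Shor1997, §3 p.8 (compute, copy, undo)] -/
noncomputable def binOps (n₀ : ℕ) (v : List Bool) (m z₀ : ℕ) : List (ClOp ℕ) :=
  cleanOps e M n₀ v ++ (copyOps (bitPairs e M (n₀ + v.length) m z₀) ++ cleanOps e M n₀ v)

variable {e M}

/-- Members of the copy pairs. [folklore] -/
theorem mem_bitPairs {n m z₀ : ℕ} {p : ℕ × ℕ} :
    p ∈ bitPairs e M n m z₀ ↔ ∃ j < m, p = (resW e M n j (symTrue M), z₀ + j) := by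
  simp only [bitPairs, List.mem_map, List.mem_range]
  constructor
  · rintro ⟨j, hj, rfl⟩; exact ⟨j, hj, rfl⟩
  · rintro ⟨j, hj, rfl⟩; exact ⟨j, hj, rfl⟩

/-- The copy targets are pairwise distinct. [folklore] -/
theorem nodup_bitPairs_snd (n m z₀ : ℕ) : ((bitPairs e M n m z₀).map Prod.snd).Nodup := by
  rw [bitPairs, List.map_map]
  exact List.nodup_range.map fun a b h => by simpa using h

/-- For `z₀ ≥ width` and `m ≤ JJ`, no copy target is a copy source (sources are result wires
`< width`, targets `≥ z₀`). [folklore] -/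
theorem bitPairs_disjoint {n m z₀ : ℕ} (hz : width e M n ≤ z₀) (hmJ : m ≤ JJ e M n) :
    ∀ p ∈ bitPairs e M n m z₀, ∀ q ∈ bitPairs e M n m z₀, q.2 ≠ p.1 := by
  intro p hp q hq h
  obtain ⟨j, hj, rfl⟩ := mem_bitPairs.1 hp
  obtain ⟨j', -, rfl⟩ := mem_bitPairs.1 hq
  have h1 := resW_lt_width (e := e) (M := M) (lt_of_lt_of_le hj hmJ) (symTrue M)
  simp only at h
  omega

/-- **Semantics of the binary block.** If `M`, started on `d ++ v`, halts with output word `l'`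
within `T(n)` steps, `m ≤ |l'|` and `z₀ ≥ width`, then the block maps `d 0 0 …` to: data unchanged,
wire `z₀ + j` holding `l'[j]` for `j < m`, every other wire `0` — the output bits in plain binary and
no garbage. [cite: Shor1997, §3 p.8] [cite: NielsenChuang2010, §3.2.5 eq. (3.7)] -/
theorem clEval_binOps (d v l' : List Bool)
    (hM : M.OutputsWithin (d ++ v) l' (Tn e (d.length + v.length))) {m z₀ : ℕ} (hm : m ≤ l'.length)
    (hz : width e M (d.length + v.length) ≤ z₀) :
    clEval (binOps e M d.length v m z₀) (strW d) = fun i =>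
      if i < d.length then d.getD i false else if z₀ ≤ i ∧ i < z₀ + m then l'.getD (i - z₀) false else false := by
  set n := d.length + v.length with hn
  have hdn : d.length ≤ width e M n := (Nat.le_add_right _ _).trans ((le_NN (e := e) (M := M) n).trans (NN_le_width n))
  have hu : (d ++ v).length = n := by simp [hn]
  obtain ⟨hL, -⟩ := length_lt_JJ_of_outputsWithin (e := e) hu hM
  -- stage 1: the Bennett block
  set w₁ := clEval (cleanOps e M d.length v) (strW d) with hw₁
  have h1 : w₁ = fun i => if i < d.length then d.getD i false else readOut e M n l' i := clEval_cleanOps d v l' hM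
  -- stage 2: the copy
  set w₂ := clEval (copyOps (bitPairs e M n m z₀)) w₁ with hw₂
  have h2t : ∀ j < m, w₂ (z₀ + j) = l'.getD j false := by
    intro j hj
    have hp : (resW e M n j (symTrue M), z₀ + j) ∈ bitPairs e M n m z₀ := mem_bitPairs.2 ⟨j, hj, rfl⟩
    have := clEval_copyOps_target _ (nodup_bitPairs_snd n m z₀) (bitPairs_disjoint hz (hm.trans hL.le)) w₁ hp
    simp only at this
    rw [hw₂, this, h1]
    simp only
    have hz1 : ¬ (z₀ + j < d.length) := by omega
    have hz2 : ¬ (resW e M n j (symTrue M) < d.length) := by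
      have := NN_le_resW (e := e) (M := M) n j (symTrue M); have := le_NN (e := e) (M := M) n; omega
    rw [if_neg hz1, if_neg hz2, readOut_of_width_le l' (by omega), readOut_resW (by omega),
      outBit_symTrue_eq hu hM (by omega), Bool.false_xor, List.getD_eq_getElem]
  have h2o : ∀ i, (∀ j < m, z₀ + j ≠ i) → w₂ i = w₁ i := by
    intro i hi
    rw [hw₂, clEval_copyOps_of_ne]
    intro p hp
    obtain ⟨j, hj, rfl⟩ := mem_bitPairs.1 hp
    exact hi j hj
  -- `w₂` is `w₁` overwritten on the zone `≥ z₀`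
  have h2split : w₂ = fun i => if z₀ ≤ i then w₂ i else w₁ i := by
    funext i
    by_cases hi : z₀ ≤ i
    · rw [if_pos hi]
    · rw [if_neg hi, h2o i fun j _ h => hi (by omega)]
  -- stage 3: the block again, by the frame rule and the involution
  have hframe : ∀ op ∈ cleanOps e M d.length v, ¬ (z₀ ≤ op.target) ∧ ∀ c ∈ op.controls, ¬ (z₀ ≤ c) := by
    intro op hop
    have hw := cleanOps_lt (e := e) (M := M) op hop
    rw [← hn] at hw
    refine ⟨fun h => ?_, fun c hc h => ?_⟩
    · have := hw op.target (by simp [wiresOf]); omega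
    · have := hw c (by simp [wiresOf, hc]); omega
  rw [binOps, clEval_append, clEval_append, ← hw₁, ← hw₂, h2split,
    clEval_ite (fun i => z₀ ≤ i) _ hframe, hw₁, clEval_cleanOps_cleanOps]
  funext i
  by_cases hi : z₀ ≤ i
  · rw [if_pos hi]
    have hid : ¬ (i < d.length) := by omega
    rw [if_neg hid]
    by_cases him : i < z₀ + m
    · rw [if_pos ⟨hi, him⟩]
      obtain ⟨j, hj, rfl⟩ : ∃ j < m, i = z₀ + j := ⟨i - z₀, by omega, by omega⟩
      rw [h2t j hj, Nat.add_sub_cancel_left]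
    · rw [if_neg (fun h => him h.2), h2o i (fun j hj h => him (by omega)), h1]
      simp only
      rw [if_neg hid, readOut_of_width_le l' (by omega)]
  · rw [if_neg hi]
    simp only [strW]
    by_cases hid : i < d.length
    · rw [if_pos hid]
    · rw [if_neg hid, if_neg (fun h => hi h.1), List.getD_eq_default _ _ (not_lt.1 hid)]

/-- The operations of the binary block are well formed (`z₀ ≥ width`, `m ≤ JJ`). [folklore] -/
theorem binOps_wf {n₀ : ℕ} {v : List Bool} {m z₀ : ℕ} (hz : width e M (n₀ + v.length) ≤ z₀)
    (hmJ : m ≤ JJ e M (n₀ + v.length)) : ∀ op ∈ binOps e M n₀ v m z₀, op.WF := by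
  intro op hop
  simp only [binOps, List.mem_append] at hop
  rcases hop with h | h | h
  · exact cleanOps_wf op h
  · refine copyOps_wf (fun p hp => ?_) op h
    obtain ⟨j, hj, rfl⟩ := mem_bitPairs.1 hp
    have := resW_lt_width (e := e) (M := M) (lt_of_lt_of_le hj hmJ) (symTrue M)
    simp only
    omega
  · exact cleanOps_wf op h

/-- **The binary block uses the wires `< max width (z₀ + m)`** (for `m ≤ JJ`). [folklore] -/
theorem binOps_lt {n₀ : ℕ} {v : List Bool} {m z₀ : ℕ} (hmJ : m ≤ JJ e M (n₀ + v.length)) :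
    ∀ op ∈ binOps e M n₀ v m z₀, ∀ i ∈ wiresOf op, i < width e M (n₀ + v.length) ∨ i < z₀ + m := by
  intro op hop i hi
  simp only [binOps, List.mem_append] at hop
  rcases hop with h | h | h
  · exact Or.inl (cleanOps_lt op h i hi)
  · obtain ⟨p, hp, rfl⟩ := mem_copyOps.1 h
    obtain ⟨j, hj, rfl⟩ := mem_bitPairs.1 hp
    simp only [wiresOf, ClOp.target, ClOp.controls, List.mem_cons, List.not_mem_nil, or_false] at hi
    rcases hi with rfl | rfl
    · exact Or.inr (by omega)
    · exact Or.inl (resW_lt_width (lt_of_lt_of_le hj hmJ) _)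
  · exact Or.inl (cleanOps_lt op h i hi)

/-! ### The binary block on a pre-filled target zone -/

/-- **The binary block with a pre-filled zone**: if the wires `≥ z₀` initially hold `g` (and the
data `d` sits on the first `|d|` wires, everything else `0`), then the block keeps the data, keeps
the work wires clean, and XORs the output bits onto `z₀ … z₀ + m − 1` (the rest of the zone is
untouched). [cite: NielsenChuang2010, §3.2.5 eq. (3.7)] -/
theorem clEval_binOps_zone (d v l' : List Bool)
    (hM : M.OutputsWithin (d ++ v) l' (Tn e (d.length + v.length))) {m z₀ : ℕ} (hm : m ≤ l'.length)
    (hz : width e M (d.length + v.length) ≤ z₀) (g : ℕ → Bool) :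
    clEval (binOps e M d.length v m z₀) (fun i => if z₀ ≤ i then g i else strW d i) = fun i =>
      if z₀ ≤ i then (if i < z₀ + m then (g i ^^ l'.getD (i - z₀) false) else g i) else strW d i := by
  set n := d.length + v.length with hn
  have hdn : d.length ≤ width e M n := (Nat.le_add_right _ _).trans ((le_NN (e := e) (M := M) n).trans (NN_le_width n))
  have hu : (d ++ v).length = n := by simp [hn]
  obtain ⟨hL, -⟩ := length_lt_JJ_of_outputsWithin (e := e) hu hM
  have hframe : ∀ op ∈ cleanOps e M d.length v, ¬ (z₀ ≤ op.target) ∧ ∀ c ∈ op.controls, ¬ (z₀ ≤ c) := by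
    intro op hop
    have hw := cleanOps_lt (e := e) (M := M) op hop
    rw [← hn] at hw
    refine ⟨fun h => ?_, fun c hc h => ?_⟩
    · have := hw op.target (by simp [wiresOf]); omega
    · have := hw c (by simp [wiresOf, hc]); omega
  -- stage 1
  have h1 : clEval (cleanOps e M d.length v) (fun i => if z₀ ≤ i then g i else strW d i) =
      fun i => if z₀ ≤ i then g i else (if i < d.length then d.getD i false else readOut e M n l' i) := by
    rw [clEval_ite (fun i => z₀ ≤ i) _ hframe, clEval_cleanOps d v l' hM]
  set w₁ : ℕ → Bool := fun i => if z₀ ≤ i then g i else (if i < d.length then d.getD i false else readOut e M n l' i) with hw₁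
  -- stage 2
  set w₂ := clEval (copyOps (bitPairs e M n m z₀)) w₁ with hw₂
  have h2t : ∀ j < m, w₂ (z₀ + j) = (g (z₀ + j) ^^ l'.getD j false) := by
    intro j hj
    have hp : (resW e M n j (symTrue M), z₀ + j) ∈ bitPairs e M n m z₀ := mem_bitPairs.2 ⟨j, hj, rfl⟩
    have := clEval_copyOps_target _ (nodup_bitPairs_snd n m z₀) (bitPairs_disjoint hz (hm.trans hL.le)) w₁ hp
    simp only at this
    rw [hw₂, this, hw₁]
    simp only
    have hr : resW e M n j (symTrue M) < width e M n := resW_lt_width (by omega) _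
    have hz2 : ¬ (z₀ ≤ resW e M n j (symTrue M)) := by omega
    have hz3 : ¬ (resW e M n j (symTrue M) < d.length) := by
      have := NN_le_resW (e := e) (M := M) n j (symTrue M); have := le_NN (e := e) (M := M) n; omega
    rw [if_pos (Nat.le_add_right _ _), if_neg hz2, if_neg hz3, readOut_resW (by omega),
      outBit_symTrue_eq hu hM (by omega), List.getD_eq_getElem]
  have h2o : ∀ i, (∀ j < m, z₀ + j ≠ i) → w₂ i = w₁ i := by
    intro i hi
    rw [hw₂, clEval_copyOps_of_ne]
    intro p hp
    obtain ⟨j, hj, rfl⟩ := mem_bitPairs.1 hp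
    exact hi j hj
  have h2split : w₂ = fun i => if z₀ ≤ i then w₂ i else (if i < d.length then d.getD i false else readOut e M n l' i) := by
    funext i
    by_cases hi : z₀ ≤ i
    · rw [if_pos hi]
    · rw [if_neg hi, h2o i fun j _ h => hi (by omega), hw₁]
      simp only [hi, ↓reduceIte]
  -- stage 3
  rw [binOps, clEval_append, clEval_append, h1, ← hw₂, h2split, clEval_ite (fun i => z₀ ≤ i) _ hframe,
    clEval_cleanOps_readOut d v l' hM]
  funext i
  by_cases hi : z₀ ≤ i
  · rw [if_pos hi, if_pos hi]
    by_cases him : i < z₀ + m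
    · rw [if_pos him]
      obtain ⟨j, hj, rfl⟩ : ∃ j < m, i = z₀ + j := ⟨i - z₀, by omega, by omega⟩
      rw [h2t j hj, Nat.add_sub_cancel_left]
    · rw [if_neg him, h2o i (fun j hj h => him (by omega)), hw₁]
      simp only [hi, ↓reduceIte]
  · rw [if_neg hi, if_neg hi]

/-! ### Erasing a field that is a function of the rest of the data -/

/-- `zeroField d o m`: the word `d` with the field `[o, o + m)` cleared. [folklore] -/
def zeroField (d : List Bool) (o m : ℕ) : List Bool :=
  d.mapIdx fun i b => if o ≤ i ∧ i < o + m then false else b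

/-- The length of `zeroField`. [folklore] -/
@[simp] theorem length_zeroField (d : List Bool) (o m : ℕ) : (zeroField d o m).length = d.length := by
  simp [zeroField]

/-- The bits of `zeroField`. [folklore] -/
theorem getD_zeroField (d : List Bool) (o m i : ℕ) :
    (zeroField d o m).getD i false = if o ≤ i ∧ i < o + m then false else d.getD i false := by
  simp only [zeroField, List.getD_eq_getElem?_getD, List.getElem?_mapIdx]
  cases h : d[i]? with
  | none => simp
  | some b => simp

variable (e M)

/-- The copy of the recomputed field back onto the field: `CNOT (t₀ + j) → (o + j)`, `j < m`.
[folklore] -/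
def backPairs (m o t₀ : ℕ) : List (ℕ × ℕ) := (List.range m).map fun j => (t₀ + j, o + j)

/-- **The erase block** for a field `[o, o + m)` of the data that is a function `M` of the rest of
the data: recompute it in binary on the fresh wires `t₀ …` (`binOps`), XOR it onto the field (which
clears the field), and run `binOps` again (which clears the copy, `M` not reading the field).
[cite: NielsenChuang2010, §3.2.5 (uncomputation)] [cite: Shor1997, §3 p.8] -/
noncomputable def eraseOps (n₀ : ℕ) (v : List Bool) (m o t₀ : ℕ) : List (ClOp ℕ) :=
  binOps e M n₀ v m t₀ ++ (copyOps (backPairs m o t₀) ++ binOps e M n₀ v m t₀)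

variable {e M}

/-- Members of the back-copy pairs. [folklore] -/
theorem mem_backPairs {m o t₀ : ℕ} {p : ℕ × ℕ} : p ∈ backPairs m o t₀ ↔ ∃ j < m, p = (t₀ + j, o + j) := by
  simp only [backPairs, List.mem_map, List.mem_range]
  constructor
  · rintro ⟨j, hj, rfl⟩; exact ⟨j, hj, rfl⟩
  · rintro ⟨j, hj, rfl⟩; exact ⟨j, hj, rfl⟩

/-- **Semantics of the erase block.** Let the data `d` carry, on its field `[o, o + m)`, exactly the
first `m` output bits of `M` on `d ++ v`, and let `M` produce the same output word on the data with
the field cleared (`M` does not read the field). Then the erase block maps `d 0 0 …` to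
`zeroField d o m 0 0 …`: the field is erased and nothing else changes.
[cite: NielsenChuang2010, §3.2.5 eq. (3.7)] [cite: Shor1997, §3 p.8] -/
theorem clEval_eraseOps (d v l' : List Bool) {m o t₀ : ℕ}
    (hM : M.OutputsWithin (d ++ v) l' (Tn e (d.length + v.length)))
    (hM₀ : M.OutputsWithin (zeroField d o m ++ v) l' (Tn e (d.length + v.length)))
    (hfield : ∀ j < m, d.getD (o + j) false = l'.getD j false)
    (hm : m ≤ l'.length) (ho : o + m ≤ d.length) (ht : width e M (d.length + v.length) ≤ t₀) :
    clEval (eraseOps e M d.length v m o t₀) (strW d) = strW (zeroField d o m) := by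
  set n := d.length + v.length with hn
  have hdn : d.length ≤ width e M n := (Nat.le_add_right _ _).trans ((le_NN (e := e) (M := M) n).trans (NN_le_width n))
  -- stage 1: `binOps` on clean wires
  have h1 := clEval_binOps d v l' hM hm ht
  -- stage 2: the back copy
  set w₁ : ℕ → Bool := fun i => if i < d.length then d.getD i false else if t₀ ≤ i ∧ i < t₀ + m then l'.getD (i - t₀) false else false
    with hw₁
  have hnd : ((backPairs m o t₀).map Prod.snd).Nodup := by
    rw [backPairs, List.map_map]; exact List.nodup_range.map fun a b h => by simpa using h
  have hdis : ∀ p ∈ backPairs m o t₀, ∀ q ∈ backPairs m o t₀, q.2 ≠ p.1 := by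
    intro p hp q hq h
    obtain ⟨j, hj, rfl⟩ := mem_backPairs.1 hp
    obtain ⟨j', hj', rfl⟩ := mem_backPairs.1 hq
    simp only at h; omega
  have h2 : clEval (copyOps (backPairs m o t₀)) w₁ = fun i => if t₀ ≤ i then w₁ i else strW (zeroField d o m) i := by
    funext i
    by_cases hi : ∃ j < m, o + j = i
    · obtain ⟨j, hj, rfl⟩ := hi
      have hp : (t₀ + j, o + j) ∈ backPairs m o t₀ := mem_backPairs.2 ⟨j, hj, rfl⟩
      have := clEval_copyOps_target _ hnd hdis w₁ hp
      simp only at this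
      rw [this, hw₁]
      simp only
      have ha : o + j < d.length := by omega
      have hb : ¬ (t₀ ≤ o + j) := by omega
      have hc : ¬ (t₀ + j < d.length) := by omega
      rw [if_pos ha, if_neg hc, if_pos ⟨Nat.le_add_right _ _, by omega⟩, Nat.add_sub_cancel_left, if_neg hb,
        hfield j hj, Bool.xor_self, strW, getD_zeroField, if_pos ⟨Nat.le_add_right _ _, by omega⟩]
    · push Not at hi
      rw [clEval_copyOps_of_ne _ _ (fun p hp => by obtain ⟨j, hj, rfl⟩ := mem_backPairs.1 hp; exact hi j hj)]
      by_cases hti : t₀ ≤ i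
      · rw [if_pos hti]
      · rw [if_neg hti, hw₁, strW, getD_zeroField]
        simp only
        have hno : ¬ (o ≤ i ∧ i < o + m) := fun h => hi (i - o) (by omega) (by omega)
        rw [if_neg hno, if_neg (show ¬ (t₀ ≤ i ∧ i < t₀ + m) from fun h => hti h.1)]
        by_cases hid : i < d.length
        · rw [if_pos hid]
        · rw [if_neg hid, List.getD_eq_default _ _ (not_lt.1 hid)]
  -- stage 3: `binOps` on the data with the field cleared and the zone holding the bits
  have h3 := clEval_binOps_zone (zeroField d o m) v l' (by simpa using hM₀) hm (by simpa using ht) w₁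
  rw [length_zeroField] at h3
  rw [eraseOps, clEval_append, clEval_append, h1, h2, h3]
  funext i
  by_cases hti : t₀ ≤ i
  · rw [if_pos hti]
    have hzero : strW (zeroField d o m) i = false := by
      rw [strW, List.getD_eq_default _ _ (by rw [length_zeroField]; omega)]
    rw [hzero, hw₁]
    simp only
    have hid : ¬ (i < d.length) := by omega
    rw [if_neg hid]
    by_cases him : i < t₀ + m
    · rw [if_pos him, if_pos ⟨hti, him⟩, Bool.xor_self]
    · rw [if_neg him, if_neg (fun h => him h.2)]
  · rw [if_neg hti]

/-- The operations of the erase block are well formed (`t₀ ≥ width`, `o + m ≤ n₀`, `m ≤ JJ`). [folklore] -/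
theorem eraseOps_wf {n₀ : ℕ} {v : List Bool} {m o t₀ : ℕ} (ht : width e M (n₀ + v.length) ≤ t₀)
    (ho : o + m ≤ n₀) (hmJ : m ≤ JJ e M (n₀ + v.length)) : ∀ op ∈ eraseOps e M n₀ v m o t₀, op.WF := by
  intro op hop
  simp only [eraseOps, List.mem_append] at hop
  rcases hop with h | h | h
  · exact binOps_wf ht hmJ op h
  · refine copyOps_wf (fun p hp => ?_) op h
    obtain ⟨j, hj, rfl⟩ := mem_backPairs.1 hp
    have := le_NN (e := e) (M := M) (n₀ + v.length); have := NN_le_width (e := e) (M := M) (n₀ + v.length)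
    simp only; omega
  · exact binOps_wf ht hmJ op h

/-- The erase block uses the wires `< max width (t₀ + m)`. [folklore] -/
theorem eraseOps_lt {n₀ : ℕ} {v : List Bool} {m o t₀ : ℕ} (ho : o + m ≤ n₀)
    (hmJ : m ≤ JJ e M (n₀ + v.length)) :
    ∀ op ∈ eraseOps e M n₀ v m o t₀, ∀ i ∈ wiresOf op, i < width e M (n₀ + v.length) ∨ i < t₀ + m := by
  intro op hop i hi
  simp only [eraseOps, List.mem_append] at hop
  rcases hop with h | h | h
  · exact binOps_lt hmJ op h i hi
  · obtain ⟨p, hp, rfl⟩ := mem_copyOps.1 h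
    obtain ⟨j, hj, rfl⟩ := mem_backPairs.1 hp
    simp only [wiresOf, ClOp.target, ClOp.controls, List.mem_cons, List.not_mem_nil, or_false] at hi
    rcases hi with rfl | rfl
    · left
      have := le_NN (e := e) (M := M) (n₀ + v.length); have := NN_le_width (e := e) (M := M) (n₀ + v.length)
      omega
    · exact Or.inr (by omega)
  · exact binOps_lt hmJ op h i hi

end RevClean

end Literature.Computability.QuantumComplexity
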